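import Summits.HubbardSuperconductivity.HubbardSuperconductivity.Theorems.AnisotropyChordStiffnessVariational

/-!
# Route `AnisotropyChord` / H0 rotor rung: the variational characterisation of `m₋₁` for ANY sector vector, and
# hypothesis (K) in φ-form (bounded static density response without eigenbases)

* **`twice_invMoment_le_of_variational_general`** : for a sector vector `x` and `0 ≤ B`, the variational bound
  `2|⟨φ, x⟩|² ≤ B · Re⟨φ, (H − E₀)φ⟩` over all sector test vectors gives `2 Σᵢ |⟨vᵢ, x⟩|²/ωᵢ ≤ B`
  (`…StiffnessVariational` is the case `x = J^j_0 ψ`; here `x = ρ_k ψ` is the other use);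
* typed **(K, φ-form) `VariationalDensityResponse Δ M`** / `VariationalDensityResponseN Δ M`: `∃ κ ≥ 0`, eventually,
  `|⟨φ, ρ_k ψ⟩|² ≤ κ L² · Re⟨φ, (H − E₀)φ⟩` for all sector `φ`, `k ≠ 0` (static density response `χ_L(k)|Λ|/2 ≤ κL²`);
  links `boundedDensityResponse_of_variational` / `…N_of_variationalN`;
* FULLY VARIATIONAL END-TO-END forms: **`eventualCondensate_of_variational_hypotheses`** (two-state chain) and
  **`eventualCondensate_of_oneState_variational_hypotheses`** :
  `ρ_L → ρ ∈ (0,1) → VariationalTwistStiffnessN Δ M → VariationalDensityResponseN Δ M → TeleGaussianComparison Δ M → EventualCondensate Δ M`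
  — twist stiffness on both axes and bounded density response both in test-vector form, plus the one Gaussian crux.
-/

set_option linter.dupNamespace false

noncomputable section

open Matrix Complex Finset Filter Topology Polynomial
open scoped ComplexConjugate
open Literature.MathematicalPhysics.QuantumLattice hiding torusPhase torusNorm
open Literature.Probability.LatticeModels
open Summit.HubbardSuperconductivity.HubbardSuperconductivity.Theorems.AnisotropyChord.InsertionEntropy

namespace Summit.HubbardSuperconductivity.HubbardSuperconductivity.Theorems.AnisotropyChord.Stiffness

variable {L : ℕ} [NeZero L]

/-- **VARIATIONAL ⇒ SPECTRAL `m₋₁` bound for any sector vector (fixed `L`).**  If `x` lies in the sector `Ms`, `0 ≤ B`,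
and every sector test vector `φ` satisfies `2|⟨φ, x⟩|² ≤ B · Re⟨φ, (H − E₀)φ⟩`, then `2 Σᵢ |⟨vᵢ, x⟩|²/ωᵢ ≤ B`
(test vector `g(H) x`, `g` the Lagrange interpolant of `λ ↦ [λ > E₀]/(λ − E₀)` on the spectrum). [folklore] -/
theorem twice_invMoment_le_of_variational_general (Δ Ms : ℝ) (x : TensorIndex (TorusSite 2 L) 2 → ℂ)
    (hxK : x ∈ spinZSector (Λ := TorusSite 2 L) 1 Ms) (B : ℝ) (hB : 0 ≤ B)
    (hvar : ∀ φ : TensorIndex (TorusSite 2 L) 2 → ℂ, φ ∈ spinZSector (Λ := TorusSite 2 L) 1 Ms →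
      2 * ‖star φ ⬝ᵥ (x)‖ ^ 2
        ≤ B * (star φ ⬝ᵥ ((hcbHamiltonian L Δ
              - ((lowestEnergyInSector 1 (hcbHamiltonian L Δ) Ms : ℝ) : ℂ) • (1 : Op (TorusSite 2 L) 2)) *ᵥ φ)).re) :
    2 * ∑ i, ‖(star (⇑((hcbHamiltonian_isHermitian L Δ).eigenvectorBasis i)) ⬝ᵥ x)‖ ^ 2 / excitation L Δ Ms i ≤ B := by
  classical
  set hH := hcbHamiltonian_isHermitian L Δ
  set E₀ := lowestEnergyInSector 1 (hcbHamiltonian L Δ) Ms with hE₀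
  -- the weights `gᵢ = 1/ωᵢ` above `E₀`, `0` elsewhere
  set g : TensorIndex (TorusSite 2 L) 2 → ℝ := fun i =>
    if 0 < excitation L Δ Ms i then 1 / excitation L Δ Ms i else 0 with hg
  have hg0 : ∀ i, 0 ≤ g i := by
    intro i; simp only [hg]; split_ifs with h
    · exact le_of_lt (one_div_pos.mpr h)
    · exact le_rfl
  -- Lagrange interpolation of `g` on the spectrum
  obtain ⟨p, hp⟩ : ∃ p : ℂ[X], ∀ i, p.eval (((hH.eigenvalues i : ℝ)) : ℂ) = ((g i : ℝ) : ℂ) := by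
    set S : Finset ℂ := Finset.univ.image fun i => ((hH.eigenvalues i : ℝ) : ℂ) with hS
    refine ⟨Lagrange.interpolate S id fun z =>
      (((if 0 < z.re - E₀ then 1 / (z.re - E₀) else 0 : ℝ)) : ℂ), fun i => ?_⟩
    have hi : ((hH.eigenvalues i : ℝ) : ℂ) ∈ S := Finset.mem_image.mpr ⟨i, Finset.mem_univ _, rfl⟩
    have h := Lagrange.eval_interpolate_at_node (v := id)
      (fun z => (((if 0 < z.re - E₀ then 1 / (z.re - E₀) else 0 : ℝ)) : ℂ)) (Set.injOn_id _) hi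
    rw [id] at h
    rw [h, Complex.ofReal_re]
    simp only [hg]
    rfl
  -- the vectors
  have hφK := aeval_mulVec_mem_spinZSector Δ Ms p hxK
  have hv := hvar _ hφK
  -- amplitudes
  have hcP : ∀ i, star (⇑(hH.eigenvectorBasis i)) ⬝ᵥ (aeval (hcbHamiltonian L Δ) p *ᵥ (x))
      = ((g i : ℝ) : ℂ) * (star (⇑(hH.eigenvectorBasis i)) ⬝ᵥ x) := by
    intro i
    rw [eigen_dotProduct_aeval_mulVec, hp i]
  have hvan : ∀ i, excitation L Δ Ms i < 0 → (star (⇑(hH.eigenvectorBasis i)) ⬝ᵥ x) = 0 :=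
    fun i hi => sectorVanishing L Δ Ms hxK i hi
  -- m := Σ gᵢ |cᵢ|²
  set m : ℝ := ∑ i, g i * ‖(star (⇑(hH.eigenvectorBasis i)) ⬝ᵥ x)‖ ^ 2 with hm
  have hm0 : 0 ≤ m := Finset.sum_nonneg fun i _ => mul_nonneg (hg0 i) (sq_nonneg _)
  -- (1) ⟨φ₀, x⟩ = m
  have h1 : star (aeval (hcbHamiltonian L Δ) p *ᵥ (x)) ⬝ᵥ (x)
      = ((m : ℝ) : ℂ) := by
    have hpar := sum_dotProduct_mulVec_mul_dotProduct hH 1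
      (aeval (hcbHamiltonian L Δ) p *ᵥ (x)) (x)
    simp only [Matrix.one_mulVec] at hpar
    rw [← hpar, hm, Complex.ofReal_sum]
    refine Finset.sum_congr rfl fun i _ => ?_
    rw [Matrix.star_dotProduct (aeval (hcbHamiltonian L Δ) p *ᵥ (x))
      (⇑(hH.eigenvectorBasis i)), hcP i]
    exact star_real_mul_mul _ _
  -- (2) ⟨φ₀, (H − E₀) φ₀⟩ = m
  have h2 : star (aeval (hcbHamiltonian L Δ) p *ᵥ (x))
        ⬝ᵥ ((hcbHamiltonian L Δ - ((E₀ : ℝ) : ℂ) • (1 : Op (TorusSite 2 L) 2))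
            *ᵥ (aeval (hcbHamiltonian L Δ) p *ᵥ (x)))
      = ((m : ℝ) : ℂ) := by
    have hpar := sum_dotProduct_mulVec_mul_dotProduct hH 1
      (aeval (hcbHamiltonian L Δ) p *ᵥ (x))
      ((hcbHamiltonian L Δ - ((E₀ : ℝ) : ℂ) • (1 : Op (TorusSite 2 L) 2))
            *ᵥ (aeval (hcbHamiltonian L Δ) p *ᵥ (x)))
    simp only [Matrix.one_mulVec] at hpar
    rw [← hpar, hm, Complex.ofReal_sum]
    refine Finset.sum_congr rfl fun i _ => ?_
    rw [Matrix.star_dotProduct (aeval (hcbHamiltonian L Δ) p *ᵥ (x))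
      (⇑(hH.eigenvectorBasis i)), eigen_dotProduct_shift_mulVec, hcP i]
    have hωdef : hH.eigenvalues i - E₀ = excitation L Δ Ms i := rfl
    rw [hωdef]
    simp only [hg]
    exact star_real_mul_mul_shift _ _
  -- (3) the variational inequality at φ₀: 2 m² ≤ B m
  have h3 : 2 * m ^ 2 ≤ B * m := by
    have hnorm : ‖((m : ℝ) : ℂ)‖ ^ 2 = m ^ 2 := by rw [Complex.norm_real, Real.norm_eq_abs, sq_abs]
    rw [h1, h2, hnorm, Complex.ofReal_re] at hv
    exact hv
  -- (4) the target equals 2m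
  have h4 : ∑ i, ‖(star (⇑(hH.eigenvectorBasis i)) ⬝ᵥ x)‖ ^ 2 / excitation L Δ Ms i = m := by
    rw [hm]
    refine Finset.sum_congr rfl fun i _ => ?_
    by_cases hpos : 0 < excitation L Δ Ms i
    · have hgi : g i = 1 / excitation L Δ Ms i := by simp only [hg]; rw [if_pos hpos]
      rw [hgi]; ring
    · have hgi : g i = 0 := by simp only [hg]; rw [if_neg hpos]
      rcases lt_or_eq_of_le (not_lt.mp hpos) with hneg | hzero
      · rw [hvan i hneg, hgi]; simp
      · rw [hzero, hgi]; simp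
  rw [h4]
  -- (5) conclude
  rcases eq_or_lt_of_le hm0 with hmz | hmpos
  · rw [← hmz]; linarith
  · nlinarith


/-! ## Hypothesis (K) in φ-form -/

/-- **HYPOTHESIS (K, φ-form) — `VariationalDensityResponse`**: bounded static density response at every `k ≠ 0`, stated
with sector test vectors: `∃ κ ≥ 0`, eventually in `L`, for the Perron amplitudes of both sectors `M_L`, `M_L − 1`, all
`k ≠ 0` and all `φ` in the sector, `2|⟨φ, ρ_k ψ⟩|² ≤ 2κL² · Re⟨φ, (H − E₀)φ⟩` (⟺ `m₋₁(ρ_k) ≤ κL²`, i.e. clause (ii) of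
`UniformSusceptibility` / `BoundedDensityResponse`). [conjecture: theory seat hubbard-h0-rotor-theory-1, cycle 8, 2026-08-28 — hypothesis (K) of H0, variational form (memo ROTOR-THEORY-8 §124 (e))] -/
def VariationalDensityResponse (Δ : ℝ) (M : ℕ → ℝ) : Prop :=
  ∃ κ ≥ (0 : ℝ), ∀ᶠ L : ℕ in atTop, ∀ [NeZero L],
    ∀ a : TensorIndex (TorusSite 2 L) 2 → ℝ, ∀ M' ∈ ({M L, M L - 1} : Set ℝ),
      IsPerronSectorGroundAmplitude L Δ M' a → ∀ k : TorusSite 2 L, k ≠ 0 →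
        ∀ φ : TensorIndex (TorusSite 2 L) 2 → ℂ, φ ∈ spinZSector (Λ := TorusSite 2 L) 1 M' →
          2 * ‖star φ ⬝ᵥ (densityModeOp L k *ᵥ toC L a)‖ ^ 2
            ≤ (2 * κ * (L : ℝ) ^ 2)
              * (star φ ⬝ᵥ ((hcbHamiltonian L Δ
                  - ((lowestEnergyInSector 1 (hcbHamiltonian L Δ) M' : ℝ) : ℂ) • (1 : Op (TorusSite 2 L) 2)) *ᵥ φ)).re

/-- **HYPOTHESIS (K, φ-form)^N — `VariationalDensityResponseN`**: the same for the Perron amplitude of the sector `M_L`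
only. [conjecture: theory seat hubbard-h0-rotor-theory-1, cycle 9, 2026-08-28 — hypothesis (K) of H0, variational form, N-sector] -/
def VariationalDensityResponseN (Δ : ℝ) (M : ℕ → ℝ) : Prop :=
  ∃ κ ≥ (0 : ℝ), ∀ᶠ L : ℕ in atTop, ∀ [NeZero L],
    ∀ a : TensorIndex (TorusSite 2 L) 2 → ℝ, IsPerronSectorGroundAmplitude L Δ (M L) a →
      ∀ k : TorusSite 2 L, k ≠ 0 →
        ∀ φ : TensorIndex (TorusSite 2 L) 2 → ℂ, φ ∈ spinZSector (Λ := TorusSite 2 L) 1 (M L) →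
          2 * ‖star φ ⬝ᵥ (densityModeOp L k *ᵥ toC L a)‖ ^ 2
            ≤ (2 * κ * (L : ℝ) ^ 2)
              * (star φ ⬝ᵥ ((hcbHamiltonian L Δ
                  - ((lowestEnergyInSector 1 (hcbHamiltonian L Δ) (M L) : ℝ) : ℂ) • (1 : Op (TorusSite 2 L) 2)) *ᵥ φ)).re

/-- **(K, φ-form) ⇒ (K′) (PROVED).** [folklore] -/
theorem boundedDensityResponse_of_variational (Δ : ℝ) (M : ℕ → ℝ) (h : VariationalDensityResponse Δ M) :
    BoundedDensityResponse Δ M := by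
  obtain ⟨κ, hκ, hev⟩ := h
  refine ⟨κ, ?_⟩
  filter_upwards [hev] with L hL
  intro _ a M' hM' ha k hk
  have hxK : densityModeOp L k *ᵥ toC L a ∈ spinZSector (Λ := TorusSite 2 L) 1 M' :=
    densityModeOp_mulVec_mem_spinZSector L k M' ha.sector
  have h2 := twice_invMoment_le_of_variational_general Δ M' (densityModeOp L k *ᵥ toC L a) hxK
    (2 * κ * (L : ℝ) ^ 2) (by positivity) (hL a M' hM' ha k hk)
  have e : ∀ i, star (⇑((hcbHamiltonian_isHermitian L Δ).eigenvectorBasis i)) ⬝ᵥ (densityModeOp L k *ᵥ toC L a)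
      = densityAmp L Δ a k i := fun i => rfl
  simp only [e] at h2
  linarith

/-- **(K, φ-form)^N ⇒ (K′)^N (PROVED).** [folklore] -/
theorem boundedDensityResponseN_of_variationalN (Δ : ℝ) (M : ℕ → ℝ) (h : VariationalDensityResponseN Δ M) :
    BoundedDensityResponseN Δ M := by
  obtain ⟨κ, hκ, hev⟩ := h
  refine ⟨κ, ?_⟩
  filter_upwards [hev] with L hL
  intro _ a ha k hk
  have hxK : densityModeOp L k *ᵥ toC L a ∈ spinZSector (Λ := TorusSite 2 L) 1 (M L) :=
    densityModeOp_mulVec_mem_spinZSector L k (M L) ha.sector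
  have h2 := twice_invMoment_le_of_variational_general Δ (M L) (densityModeOp L k *ᵥ toC L a) hxK
    (2 * κ * (L : ℝ) ^ 2) (by positivity) (hL a ha k hk)
  have e : ∀ i, star (⇑((hcbHamiltonian_isHermitian L Δ).eigenvectorBasis i)) ⬝ᵥ (densityModeOp L k *ᵥ toC L a)
      = densityAmp L Δ a k i := fun i => rfl
  simp only [e] at h2
  linarith

/-- **THE H0 ROTOR RUNG WITH BOTH PHYSICAL HYPOTHESES IN φ-FORM (two-state chain):** «twist stiffness on both axes +
bounded density response, both as variational statements over sector test vectors, + infrared Gaussianity H1′ ⇒ BEC». [folklore] -/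
theorem eventualCondensate_of_variational_hypotheses (Δ : ℝ) (M : ℕ → ℝ) (ρ : ℝ)
    (hρ : ρ ∈ Set.Ioo (0 : ℝ) 1)
    (hlim : Tendsto (fun L : ℕ => 1 / 2 + M L / (L : ℝ) ^ 2) atTop (nhds ρ))
    (hsect : ∀ᶠ L : ℕ in atTop, ∀ [NeZero L], spinZSector (Λ := TorusSite 2 L) 1 (M L - 1) ≠ ⊥)
    (hS : VariationalTwistStiffness Δ M) (hK : VariationalDensityResponse Δ M)
    (hG : GaussianInsertionComparison Δ M) : EventualCondensate Δ M :=
  eventualCondensate_of_variational_stiffness_densityResponse Δ M ρ hρ hlim hsect hS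
    (boundedDensityResponse_of_variational Δ M hK) hG

/-- **THE ONE-STATE H0 ROTOR RUNG WITH BOTH PHYSICAL HYPOTHESES IN φ-FORM:** along `ρ_L → ρ ∈ (0,1)`,
`VariationalTwistStiffnessN → VariationalDensityResponseN → TeleGaussianComparison → EventualCondensate` — stiffness and
compressibility as test-vector inequalities on ONE sector sequence, plus the single Gaussian-domination crux; every
analytic step (m₋₁ characterisation, reflection symmetry, TWIST-IR with the Lieb–Robinson far field, f-sum rule,
LEMMA ZM, one-state entropy floor, lattice sums) is a tree theorem. [folklore] -/
theorem eventualCondensate_of_oneState_variational_hypotheses (Δ : ℝ) (M : ℕ → ℝ) (ρ : ℝ)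
    (hρ : ρ ∈ Set.Ioo (0 : ℝ) 1)
    (hlim : Tendsto (fun L : ℕ => 1 / 2 + M L / (L : ℝ) ^ 2) atTop (nhds ρ))
    (hS : VariationalTwistStiffnessN Δ M) (hK : VariationalDensityResponseN Δ M)
    (hG : TeleGaussianComparison Δ M) : EventualCondensate Δ M :=
  eventualCondensate_of_oneState_variational Δ M ρ hρ hlim hS (boundedDensityResponseN_of_variationalN Δ M hK) hG

end Summit.HubbardSuperconductivity.HubbardSuperconductivity.Theorems.AnisotropyChord.Stiffness
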